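import Summits.ResolutionOfSingularities.ResolutionOfSingularities.Theorems.HomologicalConductorNoZenoHsplitUpstairs
import Summits.ResolutionOfSingularities.ResolutionOfSingularities.Theorems.HomologicalConductorNoZenoUnramifiedPoints
import Literature.AlgebraicGeometry.Resolution.BlowupsFlatBaseChange
import Literature.AlgebraicGeometry.Resolution.StalkIdealLemmas
import Literature.AlgebraicGeometry.Resolution.HilbertSamuelIsolatedSingularities
import HarnessLib

/-!
# Crux `NoZenoR` (stmt-ResolutionOfSingularities-19943), slot 5 `stub_L1wCoreF3`, seam0 (BC-ρ) + (S3b): the upstairs centre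
# `σ⁻¹(sepNodes π)` and the PULLED-BACK NODE BLOW-UP `ρ_f = ρ ×_X X_f` is the blow-up of its vanishing ideal

OURS (cell res-hironaka, chain W4.4; CONVERT seat res-D-pv-045 g8; objects (S3b) and seam0 (BC-ρ) of res-L0-w44-plan-1 DESK WORD 24 /
lead res-L0-w44-lead-1 g9 seam0 SPEC «UPSTAIRS TRANSFER PACKAGE» (U3)).  Nothing here is a statement of the manuscript under review
(Hironaka 2017); AI-written, weaker than expert review; def-free, fact-free.

Setting: `π : X → Spec R` proper over a Noetherian local `R` with finitely many integral exceptional curves, so that the κ^sep-node set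
`sepNodes π` is a finite closed set of closed points (res-L1-type-o5 `…NoZenoSepNodesFinite`); `σ : X_f → X` (in ROUTE M the base change
`pullback.fst π σ₀` of the finite étale one-root germ `σ₀ : Spec D_f → Spec D`); `ρ : X¹ → X` the blow-up of (the closure of) `sepNodes π`.

* (S3b) `isClosed_preimage_sepNodes`, `finite_preimage_sepNodes` (`σ` locally quasi-finite, quasi-compact), `height_eq_zero_of_preimage_sepNodes`,
  `isClosed_singleton_of_preimage_sepNodes` (`σ` universally closed, locally quasi-finite: res-L0-w44-stub-2's `height_apply_eq`) — the
  centre binders `hNc`/`hNfin`/`hNcl` of `FiniteCentreBlowup.subdivision_finiteCentre` and of `hsplit_upstairs_of_isBlowup` for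
  `N := σ⁻¹(sepNodes π)`; `hsplit_upstairs_of_isBlowup'` — (S3) with them discharged.
* (BC-ρ) `stalkIdeal_comap_vanishingIdeal_eq`, **`comap_vanishingIdeal_eq_of_finite`** — for finite closed sets of closed points
  `N ⊆ X` and `σ⁻¹N ⊆ X_f` and `σ` UNRAMIFIED at the points over `N` (`𝔪_{σ z₁}·𝒪_{X_f,z₁} = 𝔪_{z₁}`, stub-2's `hunr` currency,
  discharged by `map_maximalIdeal_stalkMap_eq_of_formallyUnramified` / `map_maximalIdeal_stalkMap_fst_eq`):
  `(vanishingIdeal N)·𝒪_{X_f} = vanishingIdeal (σ⁻¹N)` (checked on stalks: both are `𝔪` on the centre and `⊤` off it;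
  `le_of_forall_stalkIdeal_le`); **`isBlowup_pullback_snd_preimage_sepNodes`** — `ρ_f := pullback.snd ρ σ : X¹ ×_X X_f → X_f` IS the
  blow-up of `vanishingIdeal (σ⁻¹(sepNodes π))` for `σ` flat (Literature `IsBlowup.pullback_snd_of_flat`, GW Prop. 13.91 (2)) —
  the binder `hρ_f` of (S3)/o5; `…_of_formallyUnramified` — the same with `hunr` discharged for `σ` formally unramified and locally of
  finite type.
* **`hsplit_upstairs_pullback`** — (S3) for the pulled-back square `σ¹ := pullback.fst ρ σ`, `ρ_f := pullback.snd ρ σ`: the ONLY residual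
  inputs are the facts `h131d`, the upstairs germ data (`dim = 2`, rational, `IsResolution π_f`), the downstairs square, `hρ`, and `htwo`.

References: U. Görtz, T. Wedhorn, *Algebraic Geometry I* (2020), Prop. 13.91 (2) [`GortzWedhorn2020`]; The Stacks Project, Tag 00UW
[`StacksProject`]; J. Lipman, Publ. Math. IHÉS 36 (1969), §16 (16.1) p. 231, §24 p. 258 [`Lipman1969`].
-/

noncomputable section

-- single-problem summit: the doubled namespace component `ResolutionOfSingularities` is forced
set_option linter.dupNamespace false

namespace Summit.ResolutionOfSingularities.ResolutionOfSingularities.Theorems.NoZeno.ExcCount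

open CategoryTheory CategoryTheory.Limits AlgebraicGeometry TopologicalSpace Topology IsLocalRing
open Literature.AlgebraicGeometry.Resolution Scheme.IdealSheafData

universe u

/-! ## (S3b) The upstairs centre `σ⁻¹(sepNodes π)` is a finite closed set of closed points -/

section Centre

variable {R : Type} [CommRing R] [IsLocalRing R] {X X_f : Scheme.{0}} (π : X ⟶ Spec (.of R)) (σ : X_f ⟶ X)

/-- The upstairs centre `σ⁻¹(sepNodes π)` is closed (`π` proper over a Noetherian local `R` with finitely many exceptional curves, so that
`sepNodes π` is a finite set of closed points). [this work] -/
theorem isClosed_preimage_sepNodes [IsNoetherianRing R] [IsProper π] (hfin : (excCurvePoints π).Finite) :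
    IsClosed (σ.base ⁻¹' sepNodes π) :=
  (isClosed_sepNodes π hfin).preimage σ.base.hom.continuous

/-- The upstairs centre `σ⁻¹(sepNodes π)` is finite for `σ` locally quasi-finite and quasi-compact (e.g. finite). [this work] -/
theorem finite_preimage_sepNodes [IsNoetherianRing R] [IsProper π] [LocallyQuasiFinite σ] [QuasiCompact σ]
    (hfin : (excCurvePoints π).Finite) : (σ.base ⁻¹' sepNodes π).Finite :=
  (sepNodes_finite π hfin).preimage' fun z _ => σ.finite_preimage_singleton z

/-- Points of the upstairs centre have height `0`: `σ` universally closed and locally quasi-finite preserves `Order.height`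
(res-L0-w44-stub-2's `height_apply_eq`) and nodes have height `0`. [this work] -/
theorem height_eq_zero_of_preimage_sepNodes [UniversallyClosed σ] [LocallyQuasiFinite σ] {z₁ : X_f}
    (hz₁ : σ.base z₁ ∈ sepNodes π) : Order.height z₁ = 0 := by
  rw [← height_apply_eq σ z₁]
  exact height_eq_zero_of_mem_sepNodes π hz₁

/-- **Points of the upstairs centre are closed points.** [this work] -/
theorem isClosed_singleton_of_preimage_sepNodes [UniversallyClosed σ] [LocallyQuasiFinite σ] {z₁ : X_f}
    (hz₁ : σ.base z₁ ∈ sepNodes π) : IsClosed ({z₁} : Set X_f) := by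
  have hmin : IsMin z₁ := Order.height_eq_zero.mp (height_eq_zero_of_preimage_sepNodes π σ hz₁)
  refine isClosed_of_closure_subset fun y hy => ?_
  have hzy : z₁ ⤳ y := specializes_iff_mem_closure.mpr hy
  have hyz : y ⤳ z₁ := Scheme.le_iff_specializes.mp (hmin (Scheme.le_iff_specializes.mpr hzy))
  exact (hyz.antisymm hzy).eq

end Centre

/-! ## (BC-ρ) The inverse image of the vanishing ideal of a finite set of closed points along a morphism unramified over it -/

section Comap

variable {X Y : Scheme.{u}}

variable (σ : Y ⟶ X) {N : Set X} (hNc : IsClosed N) (hNfin : N.Finite) (hNcl : ∀ z ∈ N, IsClosed ({z} : Set X))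
  (hMc : IsClosed (σ.base ⁻¹' N)) (hMfin : (σ.base ⁻¹' N).Finite) (hMcl : ∀ y ∈ σ.base ⁻¹' N, IsClosed ({y} : Set Y))
  (hunr : ∀ y : Y, σ.base y ∈ N →
    (maximalIdeal (X.presheaf.stalk (σ.base y))).map (σ.stalkMap y).hom = maximalIdeal (Y.presheaf.stalk y))

include hNfin hNcl hMfin hMcl hunr in
/-- **Stalks of `(vanishingIdeal N)·𝒪_Y`**: for finite closed sets of closed points `N`, `σ⁻¹N` and `σ` unramified at the points over `N`,
the stalk of `σ*(vanishingIdeal N)` at every `y` is the stalk of `vanishingIdeal (σ⁻¹N)` (`𝔪_y` over `N`, `⊤` elsewhere).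
[cite: StacksProject, Tag 00UW] -/
theorem stalkIdeal_comap_vanishingIdeal_eq (y : Y) :
    stalkIdeal ((vanishingIdeal ⟨N, hNc⟩).comap σ) y = stalkIdeal (vanishingIdeal ⟨σ.base ⁻¹' N, hMc⟩) y := by
  -- off a closed set the stalk of its vanishing ideal is the unit ideal (the tree's
  -- `CampaignW46.stalkIdeal_vanishingIdeal_of_not_mem`, re-proved inline to keep the import cone small)
  have htop : ∀ {W : Scheme.{u}} (C : Closeds W) {w : W}, w ∉ (C : Set W) → stalkIdeal (vanishingIdeal C) w = ⊤ := by
    intro W C w hw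
    by_contra h
    have hmem : w ∈ ((vanishingIdeal C).support : Set W) :=
      (mem_support_iff_stalkIdeal_le _ w).mpr (IsLocalRing.le_maximalIdeal h)
    rw [coe_support_vanishingIdeal] at hmem
    exact hw hmem
  rw [stalkIdeal_comap_eq_map_stalkMap]
  by_cases hy : σ.base y ∈ N
  · rw [stalkIdeal_vanishingIdeal_of_finite (Z := ⟨N, hNc⟩) hNfin hNcl hy, hunr y hy,
      stalkIdeal_vanishingIdeal_of_finite (Z := ⟨σ.base ⁻¹' N, hMc⟩) hMfin hMcl hy]
  · rw [htop ⟨N, hNc⟩ hy, Ideal.map_top, htop ⟨σ.base ⁻¹' N, hMc⟩ hy]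

include hNfin hNcl hMfin hMcl hunr in
/-- **`(vanishingIdeal N)·𝒪_Y = vanishingIdeal (σ⁻¹N)`** for finite closed sets of closed points `N ⊆ X`, `σ⁻¹N ⊆ Y` and `σ : Y → X`
unramified at the points over `N` (ideal sheaves with equal stalks are equal, `le_of_forall_stalkIdeal_le`). [cite: StacksProject, Tag 00UW] -/
theorem comap_vanishingIdeal_eq_of_finite :
    (vanishingIdeal ⟨N, hNc⟩).comap σ = vanishingIdeal ⟨σ.base ⁻¹' N, hMc⟩ :=
  le_antisymm
    (le_of_forall_stalkIdeal_le fun y => (stalkIdeal_comap_vanishingIdeal_eq σ hNc hNfin hNcl hMc hMfin hMcl hunr y).le)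
    (le_of_forall_stalkIdeal_le fun y => (stalkIdeal_comap_vanishingIdeal_eq σ hNc hNfin hNcl hMc hMfin hMcl hunr y).ge)

/-- A blow-up pulled back along a flat `σ` is the blow-up of any ideal sheaf equal to the inverse image ideal sheaf.
[cite: GortzWedhorn2020, Prop. 13.91 (2)] -/
theorem isBlowup_pullback_snd_of_comap_eq {X1 : Scheme.{u}} (ρ : X1 ⟶ X) [Flat σ] {J : X.IdealSheafData}
    {J' : Y.IdealSheafData} (hρ : IsBlowup ρ J) (hJ : J.comap σ = J') : IsBlowup (pullback.snd ρ σ) J' :=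
  hJ ▸ hρ.pullback_snd_of_flat σ

end Comap

/-! ## (BC-ρ) The pulled-back node blow-up is the blow-up of the upstairs centre -/

section NodeBlowup

variable {R : Type} [CommRing R] [IsLocalRing R] [IsNoetherianRing R] {X X1 X_f : Scheme.{0}}
  (π : X ⟶ Spec (.of R)) (ρ : X1 ⟶ X) (σ : X_f ⟶ X)

/-- **(BC-ρ)** For `π` proper with finitely many exceptional curves, `ρ` the blow-up of (the closure of) the node set `sepNodes π`, and
`σ : X_f → X` flat, universally closed, locally quasi-finite, quasi-compact and UNRAMIFIED at the points over the nodes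
(`hunr`, res-L0-w44-stub-2's currency), the pulled-back blow-up `pullback.snd ρ σ : X¹ ×_X X_f → X_f` is the blow-up of the vanishing
ideal of the upstairs centre `σ⁻¹(sepNodes π)`. [cite: GortzWedhorn2020, Prop. 13.91 (2)] -/
theorem isBlowup_pullback_snd_preimage_sepNodes [IsProper π] [Flat σ] [UniversallyClosed σ] [LocallyQuasiFinite σ]
    [QuasiCompact σ] (hfin : (excCurvePoints π).Finite)
    (hunr : ∀ z₁ : X_f, σ.base z₁ ∈ sepNodes π →
      (maximalIdeal (X.presheaf.stalk (σ.base z₁))).map (σ.stalkMap z₁).hom = maximalIdeal (X_f.presheaf.stalk z₁))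
    (hρ : IsBlowup ρ (vanishingIdeal ⟨closure (sepNodes π), isClosed_closure⟩)) :
    IsBlowup (pullback.snd ρ σ) (vanishingIdeal ⟨σ.base ⁻¹' sepNodes π, isClosed_preimage_sepNodes π σ hfin⟩) := by
  have hC : (⟨closure (sepNodes π), isClosed_closure⟩ : Closeds X) = ⟨sepNodes π, isClosed_sepNodes π hfin⟩ :=
    Closeds.ext (closure_sepNodes_eq π hfin)
  rw [hC] at hρ
  exact isBlowup_pullback_snd_of_comap_eq σ ρ hρ
    (comap_vanishingIdeal_eq_of_finite σ (isClosed_sepNodes π hfin) (sepNodes_finite π hfin)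
      (fun z hz => isClosed_singleton_of_mem_sepNodes π hz) (isClosed_preimage_sepNodes π σ hfin)
      (finite_preimage_sepNodes π σ hfin) (fun z₁ hz₁ => isClosed_singleton_of_preimage_sepNodes π σ hz₁) hunr)

/-- **(BC-ρ), `hunr` discharged** for `σ` moreover formally unramified and locally of finite type (e.g. the base change of a finite
étale `Spec D_f → Spec D`; stub-2's `map_maximalIdeal_stalkMap_eq_of_formallyUnramified`). [cite: StacksProject, Tag 00UW] -/
theorem isBlowup_pullback_snd_preimage_sepNodes_of_formallyUnramified [IsProper π] [Flat σ] [UniversallyClosed σ]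
    [LocallyQuasiFinite σ] [QuasiCompact σ] [FormallyUnramified σ] [LocallyOfFiniteType σ] (hfin : (excCurvePoints π).Finite)
    (hρ : IsBlowup ρ (vanishingIdeal ⟨closure (sepNodes π), isClosed_closure⟩)) :
    IsBlowup (pullback.snd ρ σ) (vanishingIdeal ⟨σ.base ⁻¹' sepNodes π, isClosed_preimage_sepNodes π σ hfin⟩) :=
  isBlowup_pullback_snd_preimage_sepNodes π ρ σ hfin (fun z₁ _ => map_maximalIdeal_stalkMap_eq_of_formallyUnramified σ z₁) hρ

end NodeBlowup

/-! ## (S3) for the pulled-back square, centre binders and `hρ_f` discharged -/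

section Assembly

open Scheme.IdealSheafData

variable {R : Type} [CommRing R] [IsLocalRing R] [IsNoetherianRing R]
  {S_f : Type} [CommRing S_f] [IsNoetherianRing S_f] [IsLocalRing S_f] [IsDomain S_f] [IsIntegrallyClosed S_f]
  {X X_f X1 X1_f : Scheme.{0}} [IsIntegral X_f]
  (π : X ⟶ Spec (.of R)) (π_f : X_f ⟶ Spec (.of S_f)) (σ : X_f ⟶ X) (g : Spec (.of S_f) ⟶ Spec (.of R))
  (hsq : σ ≫ π = π_f ≫ g) (hg : g.base ⁻¹' {closedPoint R} = {closedPoint S_f})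

include hsq hg in
/-- **(S3) with the centre binders discharged**: for `π` proper with finitely many exceptional curves and `σ` moreover quasi-compact, the
blow-up `ρ_f` of the closed finite set of closed points `σ⁻¹(sepNodes π)` of the rational resolution `π_f` has two distinct exceptional
curves of `π_f` through every centre point — GIVEN only the self-node input `htwo`. [cite: Lipman1969, §24 (p. 258)] -/
theorem hsplit_upstairs_of_isBlowup' (ρ : X1 ⟶ X) (ρ_f : X1_f ⟶ X_f) (σ1 : X1_f ⟶ X1) (hcomm : σ1 ≫ ρ = ρ_f ≫ σ)
    [IsProper π] [UniversallyClosed σ] [LocallyQuasiFinite σ] [QuasiCompact σ] [Flat σ]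
    [UniversallyClosed σ1] [LocallyQuasiFinite σ1] [Flat σ1]
    (h131d : Lipman1969_13_1_d_rat.{0}) (hdim : ringKrullDim S_f = 2) (hS : HasRationalSingularity S_f)
    (hπ_f : IsResolution π_f) (hfin : (excCurvePoints π).Finite)
    (hρ_f : IsBlowup ρ_f (vanishingIdeal ⟨σ.base ⁻¹' sepNodes π, isClosed_preimage_sepNodes π σ hfin⟩))
    (htwo : ∀ z ∈ sepNodes π, ∀ η ∈ excCurvePoints π, η ⤳ z → (∀ η' ∈ excCurvePoints π, η' ⤳ z → η' = η) →
      ∀ z₁ : X_f, σ.base z₁ = z → ∃ (η1 : X1) (y₁ y₂ : X1_f), η1 ∈ excCurvePoints (ρ ≫ π) ∧ ρ.base η1 = η ∧ y₁ ≠ y₂ ∧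
        ρ_f.base y₁ = z₁ ∧ ρ_f.base y₂ = z₁ ∧ η1 ⤳ σ1.base y₁ ∧ η1 ⤳ σ1.base y₂) :
    ∀ z₁ : X_f, σ.base z₁ ∈ sepNodes π →
      ∃ a b : X_f, a ∈ excCurvePoints π_f ∧ b ∈ excCurvePoints π_f ∧ a ≠ b ∧ a ⤳ z₁ ∧ b ⤳ z₁ :=
  hsplit_upstairs_of_isBlowup π π_f σ g hsq hg ρ ρ_f σ1 hcomm h131d hdim hS hπ_f (isClosed_preimage_sepNodes π σ hfin)
    (finite_preimage_sepNodes π σ hfin) (fun _ hz₁ => isClosed_singleton_of_preimage_sepNodes π σ hz₁) hρ_f htwo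

include hsq hg in
/-- **(S3) + (BC-ρ) FOR THE PULLED-BACK SQUARE** `X¹_f := X¹ ×_X X_f`, `ρ_f := pullback.snd ρ σ`, `σ¹ := pullback.fst ρ σ`: for `σ` flat,
formally unramified, locally of finite type, universally closed, locally quasi-finite, quasi-compact (a base change of a finite étale
germ map) and `ρ` the node blow-up downstairs, two distinct exceptional curves of `π_f` pass through every point over a node — GIVEN
`h131d`, the upstairs germ data, and the self-node input `htwo`. [cite: Lipman1969, §24 (p. 258)] -/
theorem hsplit_upstairs_pullback (ρ : X1 ⟶ X) [IsProper π] [UniversallyClosed σ] [LocallyQuasiFinite σ] [QuasiCompact σ]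
    [Flat σ] [FormallyUnramified σ] [LocallyOfFiniteType σ]
    (h131d : Lipman1969_13_1_d_rat.{0}) (hdim : ringKrullDim S_f = 2) (hS : HasRationalSingularity S_f)
    (hπ_f : IsResolution π_f) (hfin : (excCurvePoints π).Finite)
    (hρ : IsBlowup ρ (vanishingIdeal ⟨closure (sepNodes π), isClosed_closure⟩))
    (htwo : ∀ z ∈ sepNodes π, ∀ η ∈ excCurvePoints π, η ⤳ z → (∀ η' ∈ excCurvePoints π, η' ⤳ z → η' = η) →
      ∀ z₁ : X_f, σ.base z₁ = z → ∃ (η1 : X1) (y₁ y₂ : ↑(pullback ρ σ)), η1 ∈ excCurvePoints (ρ ≫ π) ∧ ρ.base η1 = η ∧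
        y₁ ≠ y₂ ∧ (pullback.snd ρ σ).base y₁ = z₁ ∧ (pullback.snd ρ σ).base y₂ = z₁ ∧
        η1 ⤳ (pullback.fst ρ σ).base y₁ ∧ η1 ⤳ (pullback.fst ρ σ).base y₂) :
    ∀ z₁ : X_f, σ.base z₁ ∈ sepNodes π →
      ∃ a b : X_f, a ∈ excCurvePoints π_f ∧ b ∈ excCurvePoints π_f ∧ a ≠ b ∧ a ⤳ z₁ ∧ b ⤳ z₁ :=
  hsplit_upstairs_of_isBlowup' π π_f σ g hsq hg ρ (pullback.snd ρ σ) (pullback.fst ρ σ) pullback.condition h131d hdim hS hπ_f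
    hfin (isBlowup_pullback_snd_preimage_sepNodes_of_formallyUnramified π ρ σ hfin hρ) htwo

end Assembly

end Summit.ResolutionOfSingularities.ResolutionOfSingularities.Theorems.NoZeno.ExcCount

end
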